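import Mathlib
import Summits.CriticalPhenomena.PercolationContinuityZ3.Theorems.PinholeClosing.Negative.PinholeClosingBaseline
import Literature.Probability.Percolation.CriticalContinuityProofs
import HarnessLib

/-!
# Stub `stub_doorKill` of line `pocket-resampling-liveness-mass` (crux `PercBudgetLadder.PinholeClosing`, stmt-CriticalPhenomena-5249)

Door kill: if A is admissible for the window (n, ln) with at most k+1 open boundary edges in the lattice configuration omega, then a fresh exterior of A puts the doubled window (n, 2ln) in budget at most k with probability at least (1-p_c)^5.

Registered signature (lead prover-line-stmt-CriticalPhenomena-5249-1, skeleton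
`Cruxes/PinholeClosing/Lines/pocket_resampling_liveness_mass.lean` rev 1): proved VERBATIM below as
`Summit.CriticalPhenomena.PercolationContinuityZ3.Theorems.stub_doorKill`; helper lemmas live in `namespace StubDoorKill`.
No new definitions (tree vocabulary only).

Proof.  Write `H ω' := (ω ∩ edgesTouching A) ∪ (ω' \ edgesTouching A)` for the hybrid configuration.
* Cut property (`mem_blockedEv_of_card_le`): on lattice configurations, an admissible set of the
  window `(n, M)` with at most `k` open boundary edges blocks the window at budget `k` (close exactly
  those edges: an open path from `box n ⊆ A` can then never leave `A`, and `A` misses `∂ⁱⁿ box M`).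
* If `A` has no `ω`-open boundary edge, `H ω'` has none either (it agrees with `ω` on the edges touching
  `A`), and `A` is admissible for `(n, 2ln)`; nothing has to be closed.
* Otherwise pick a door `s(a, b)`, `a ∈ A`, `b ∉ A`, and let `X` be the (at most `6 - 1 = 5`) lattice
  edges at `b` not touching `A`.  If `ω'` closes `X` then every `H ω'`-open boundary edge of
  `insert b A` is an `ω`-open boundary edge of `A` other than `s(a, b)`: at most `k` of them, and
  `insert b A ⊆ box (ln) ⊆ box (2ln) \ ∂ⁱⁿ box (2ln)` is admissible for the doubled window.  The event
  `{ω' | X closed}` has probability `(1 - p_c)^{#X} ≥ (1 - p_c)^5` (`bondPercolation_real_setOf_disjoint`).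
-/

noncomputable section

namespace Summit.CriticalPhenomena.PercolationContinuityZ3.Theorems

open MeasureTheory Finset
open Literature.Probability.Percolation Literature.Probability.LatticeModels
open Summit.CriticalPhenomena.PercolationContinuityZ3.Theorems.PinholeClosing.Negative
open scoped Classical

namespace StubDoorKill

/-! ### The cut property of admissible sets
(adapted from Cruxes/PinholeClosing/SketchIdeator5.lean, `stays_of_boundary_subset`,
`mem_bEv_of_openBdry_le`) -/

/-- Paths of `ξ \ S` inside the window that start in `A` stay in `A` when every `ξ`-open boundary
edge of `A` lies in `S` (lattice configurations). [folklore] -/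
-- adapted from Cruxes/PinholeClosing/SketchIdeator5.lean (`stays_of_boundary_subset`)
theorem stays_of_boundary_subset {A : Finset (Site 3)} {ξ : BondConfig (Site 3)}
    {S : Finset (Sym2 (Site 3))} {m : ℕ} (hξ : ξ ⊆ (zdGraph 3).edgeSet)
    (hS : ∀ e ∈ edgeBoundary (zdGraph 3) A, e ∈ ξ → e ∈ S)
    (u v : (↑(box 3 m) : Set (Site 3)))
    (huv : ((openGraph (ξ \ ↑S)).induce (↑(box 3 m) : Set (Site 3))).Reachable u v)
    (hu : (u : Site 3) ∈ A) : (v : Site 3) ∈ A := by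
  rw [SimpleGraph.reachable_iff_reflTransGen] at huv
  induction huv with
  | refl => exact hu
  | @tail b c _ hbc ih =>
    simp only [SimpleGraph.induce_adj, openGraph_adj, Set.mem_sdiff, Finset.mem_coe] at hbc
    obtain ⟨⟨hopen, hnotS⟩, _⟩ := hbc
    by_contra hc
    exact hnotS (hS _ ((mem_edgeBoundary_iff).2
      ⟨hξ hopen, ⟨(b : Site 3), ih, Sym2.mem_mk_left _ _⟩,
        ⟨(c : Site 3), hc, Sym2.mem_mk_right _ _⟩⟩) hopen)

/-- **Cut property.** If `A` is admissible for the window `(n, m)` (`box n ⊆ A ⊆ box m \ ∂ⁱⁿ box m`)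
and has at most `k` `ξ`-open boundary edges, then the lattice configuration `ξ` is blocked at
budget `k`: close exactly those edges. [folklore] -/
-- adapted from Cruxes/PinholeClosing/SketchIdeator5.lean (`mem_bEv_of_openBdry_le`)
theorem mem_blockedEv_of_card_le {k n m : ℕ} {ξ : BondConfig (Site 3)} {A : Finset (Site 3)}
    (hξ : ξ ⊆ (zdGraph 3).edgeSet) (hnA : box 3 n ⊆ A)
    (hAm : A ⊆ box 3 m \ innerBoundary (zdGraph 3) (box 3 m))
    (hk : ((edgeBoundary (zdGraph 3) A).filter (· ∈ ξ)).card ≤ k) :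
    ξ ∈ {ω : BondConfig (Site 3) | ∃ S : Finset (Sym2 (Site 3)), S.card ≤ k ∧ ¬ ∃ x ∈ box 3 n,
      ∃ y ∈ innerBoundary (zdGraph 3) (box 3 m),
        (ω \ (↑S : Set (Sym2 (Site 3)))) ∈ openConnIn (↑(box 3 m) : Set (Site 3)) x y} := by
  refine ⟨(edgeBoundary (zdGraph 3) A).filter (· ∈ ξ), hk, ?_⟩
  rintro ⟨x, hx, y, hy, hxS, hyS, hr⟩
  have hS : ∀ e ∈ edgeBoundary (zdGraph 3) A, e ∈ ξ →
      e ∈ (edgeBoundary (zdGraph 3) A).filter (· ∈ ξ) :=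
    fun e he heξ => Finset.mem_filter.2 ⟨he, heξ⟩
  have hyA : y ∈ A := stays_of_boundary_subset hξ hS ⟨x, hxS⟩ ⟨y, hyS⟩ hr (hnA hx)
  have hy' := hAm hyA
  rw [Finset.mem_sdiff] at hy'
  exact hy'.2 hy

/-- `box L ⊆ box M \ ∂ⁱⁿ box M` for `L < M`: a smaller box misses the sink sphere. [folklore] -/
theorem box_subset_sdiff {L M : ℕ} (h : L < M) :
    box 3 L ⊆ box 3 M \ innerBoundary (zdGraph 3) (box 3 M) := fun _ hv =>
  Finset.mem_sdiff.2 ⟨box_mono 3 h.le hv, fun hv' => notMem_box_of_mem_innerBoundary h hv' hv⟩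

/-! ### The hybrid configuration and the doors of `insert b A` -/

/-- Boundary edges of `A` touch `A`. [folklore] -/
theorem edgeBoundary_subset_edgesTouching (A : Finset (Site 3)) :
    edgeBoundary (zdGraph 3) A ⊆ edgesTouching (zdGraph 3) A := by
  intro e he
  rw [mem_edgeBoundary_iff] at he
  exact mem_edgesTouching_iff.2 ⟨he.1, he.2.1⟩

/-- A configuration `H` agreeing with `ω` on the edges touching `A` has the same open boundary edges
of `A` as `ω`. [folklore] -/
theorem doors_eq_of_agree {A : Finset (Site 3)} {ω H : BondConfig (Site 3)}
    (hH : ∀ f ∈ edgesTouching (zdGraph 3) A, f ∈ H ↔ f ∈ ω) :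
    (edgeBoundary (zdGraph 3) A).filter (· ∈ H) = (edgeBoundary (zdGraph 3) A).filter (· ∈ ω) :=
  Finset.filter_congr fun f hf => hH f (edgeBoundary_subset_edgesTouching A hf)

/-- **Door bookkeeping.** Let `a ∈ A`, `b ∉ A`, let `H` agree with `ω` on the edges touching `A`
and with `ω'` elsewhere, and let `ω'` close every lattice edge at `b` not touching `A`.  Then every
`H`-open boundary edge of `insert b A` is an `ω`-open boundary edge of `A` other than `s(a, b)`.
[folklore] -/
theorem doors_insert_subset {A : Finset (Site 3)} {ω ω' H : BondConfig (Site 3)} {a b : Site 3}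
    (ha : a ∈ A) (hb : b ∉ A)
    (hH : ∀ f ∈ edgesTouching (zdGraph 3) A, f ∈ H ↔ f ∈ ω)
    (hH' : ∀ f ∉ edgesTouching (zdGraph 3) A, f ∈ H ↔ f ∈ ω')
    (hd : Disjoint (↑((zdGraph 3).incidenceFinset b \ edgesTouching (zdGraph 3) A) :
      Set (Sym2 (Site 3))) ω') :
    (edgeBoundary (zdGraph 3) (insert b A)).filter (· ∈ H) ⊆
      ((edgeBoundary (zdGraph 3) A).filter (· ∈ ω)).erase s(a, b) := by
  intro f hf
  rw [Finset.mem_filter, mem_edgeBoundary_iff] at hf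
  obtain ⟨⟨hfE, ⟨u, hu, huf⟩, ⟨v, hv, hvf⟩⟩, hfH⟩ := hf
  rw [Finset.mem_insert, not_or] at hv
  rw [Finset.mem_insert] at hu
  have huv : u ≠ v := by
    rintro rfl
    rcases hu with rfl | hu
    · exact hv.1 rfl
    · exact hv.2 hu
  obtain rfl : f = s(u, v) := (Sym2.mem_and_mem_iff huv).1 ⟨huf, hvf⟩
  rcases hu with rfl | huA
  · -- `f = s(b, v)` is a fresh edge at `b`, closed in `ω'`: it cannot be `H`-open
    exfalso
    have hfT : s(u, v) ∉ edgesTouching (zdGraph 3) A := by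
      rw [mem_edgesTouching_iff]
      rintro ⟨-, x, hxA, hx⟩
      rcases Sym2.mem_iff.1 hx with rfl | rfl
      · exact hb hxA
      · exact hv.2 hxA
    refine Set.disjoint_left.1 hd ?_ ((hH' _ hfT).1 hfH)
    rw [Finset.mem_coe, Finset.mem_sdiff, SimpleGraph.mem_incidenceFinset,
      SimpleGraph.mk'_mem_incidenceSet_left_iff]
    exact ⟨hfE, hfT⟩
  · -- `u ∈ A`: an old door of `A`; `H`-open means `ω`-open, and it is not `s(a, b)`
    have hfbd : s(u, v) ∈ edgeBoundary (zdGraph 3) A :=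
      mem_edgeBoundary_iff.2
        ⟨hfE, ⟨u, huA, Sym2.mem_mk_left _ _⟩, ⟨v, hv.2, Sym2.mem_mk_right _ _⟩⟩
    have hfω : s(u, v) ∈ ω := (hH _ (edgeBoundary_subset_edgesTouching A hfbd)).1 hfH
    rw [Finset.mem_erase, Finset.mem_filter]
    refine ⟨fun hfe => ?_, hfbd, hfω⟩
    have hv' : v ∈ s(a, b) := hfe ▸ Sym2.mem_mk_right u v
    rcases Sym2.mem_iff.1 hv' with rfl | rfl
    · exact hv.2 ha
    · exact hv.1 rfl

/-- At most `5 = 6 - 1` lattice edges at the far endpoint `b` of a lattice edge `s(a, b)`, `a ∈ A`,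
avoid `A`. [folklore] -/
theorem card_fresh_le {A : Finset (Site 3)} {a b : Site 3} (ha : a ∈ A)
    (he : s(a, b) ∈ (zdGraph 3).edgeSet) :
    ((zdGraph 3).incidenceFinset b \ edgesTouching (zdGraph 3) A).card ≤ 5 := by
  have hsub : (zdGraph 3).incidenceFinset b \ edgesTouching (zdGraph 3) A ⊆
      ((zdGraph 3).incidenceFinset b).erase s(a, b) := by
    intro f hf
    rw [Finset.mem_sdiff] at hf
    rw [Finset.mem_erase]
    refine ⟨?_, hf.1⟩
    rintro rfl
    exact hf.2 (mem_edgesTouching_iff.2 ⟨he, a, ha, Sym2.mem_mk_left _ _⟩)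
  have hmem : s(a, b) ∈ (zdGraph 3).incidenceFinset b := by
    rw [SimpleGraph.mem_incidenceFinset, SimpleGraph.mk'_mem_incidenceSet_right_iff]
    exact he
  have hdeg : ((zdGraph 3).incidenceFinset b).card = 2 * 3 := by
    rw [SimpleGraph.card_incidenceFinset_eq_degree, ← SimpleGraph.card_neighborFinset_eq_degree]
    exact card_neighborFinset_zdGraph_holds b
  have h := Finset.card_le_card hsub
  rw [Finset.card_erase_of_mem hmem, hdeg] at h
  exact h

/-- **Deterministic door kill.** Under the hypotheses of the stub there is a set `X` of at most `5`
lattice edges such that, for every lattice `ω'` closing `X`, the hybrid configuration is blocked at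
budget `k` in the doubled window `(n, 2ln)`. [folklore] -/
theorem exists_killSet {k n l : ℕ} {A : Finset (Site 3)} {ω : BondConfig (Site 3)}
    (hl : 2 ≤ l) (hn : 1 ≤ n) (hω : ω ⊆ (zdGraph 3).edgeSet)
    (hA : box 3 n ⊆ A ∧ A ⊆ box 3 (l * n) \ innerBoundary (zdGraph 3) (box 3 (l * n)))
    (hcard : ((edgeBoundary (zdGraph 3) A).filter (· ∈ ω)).card ≤ k + 1) :
    ∃ X : Finset (Sym2 (Site 3)), (↑X : Set (Sym2 (Site 3))) ⊆ (zdGraph 3).edgeSet ∧ X.card ≤ 5 ∧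
      ∀ ω' : BondConfig (Site 3), ω' ⊆ (zdGraph 3).edgeSet →
        Disjoint (↑X : Set (Sym2 (Site 3))) ω' →
        (ω ∩ ↑(edgesTouching (zdGraph 3) A)) ∪ (ω' \ ↑(edgesTouching (zdGraph 3) A)) ∈
          {ξ : BondConfig (Site 3) | ∃ S : Finset (Sym2 (Site 3)), S.card ≤ k ∧ ¬ ∃ x ∈ box 3 n,
            ∃ y ∈ innerBoundary (zdGraph 3) (box 3 (2 * l * n)),
              (ξ \ (↑S : Set (Sym2 (Site 3)))) ∈
                openConnIn (↑(box 3 (2 * l * n)) : Set (Site 3)) x y} := by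
  have hlt : l * n < 2 * l * n := by
    have : 0 < l * n := Nat.mul_pos (by omega) (by omega)
    rw [Nat.mul_assoc]
    omega
  have hbox : box 3 (l * n) ⊆ box 3 (2 * l * n) \ innerBoundary (zdGraph 3) (box 3 (2 * l * n)) :=
    box_subset_sdiff hlt
  have hAbox : A ⊆ box 3 (l * n) := hA.2.trans Finset.sdiff_subset
  have hH : ∀ ω' : BondConfig (Site 3), ω' ⊆ (zdGraph 3).edgeSet →
      (ω ∩ ↑(edgesTouching (zdGraph 3) A)) ∪ (ω' \ ↑(edgesTouching (zdGraph 3) A)) ⊆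
        (zdGraph 3).edgeSet :=
    fun ω' hω' => Set.union_subset (Set.inter_subset_left.trans hω) (Set.sdiff_subset.trans hω')
  have hT : ∀ (ω' : BondConfig (Site 3)), ∀ f ∈ edgesTouching (zdGraph 3) A,
      f ∈ (ω ∩ ↑(edgesTouching (zdGraph 3) A)) ∪ (ω' \ ↑(edgesTouching (zdGraph 3) A)) ↔ f ∈ ω :=
    fun ω' f hf => by simp [hf]
  have hT' : ∀ (ω' : BondConfig (Site 3)), ∀ f ∉ edgesTouching (zdGraph 3) A,
      f ∈ (ω ∩ ↑(edgesTouching (zdGraph 3) A)) ∪ (ω' \ ↑(edgesTouching (zdGraph 3) A)) ↔ f ∈ ω' :=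
    fun ω' f hf => by simp [hf]
  rcases ((edgeBoundary (zdGraph 3) A).filter (· ∈ ω)).eq_empty_or_nonempty with h0 | ⟨e, he⟩
  · -- no door: nothing to close, `A` itself is admissible for the doubled window
    refine ⟨∅, by simp, by simp, fun ω' hω' _ => ?_⟩
    refine mem_blockedEv_of_card_le (hH ω' hω') hA.1 (hAbox.trans hbox) ?_
    rw [doors_eq_of_agree (hT ω'), h0, Finset.card_empty]
    exact Nat.zero_le _
  · -- a door `s(a, b)`, `a ∈ A`, `b ∉ A`: close the fresh edges at `b`
    obtain ⟨hebd, -⟩ := Finset.mem_filter.1 he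
    obtain ⟨heE, ⟨a, ha, hae⟩, ⟨b, hb, hbe⟩⟩ := mem_edgeBoundary_iff.1 hebd
    have hab : a ≠ b := fun h => hb (h ▸ ha)
    obtain rfl : e = s(a, b) := (Sym2.mem_and_mem_iff hab).1 ⟨hae, hbe⟩
    refine ⟨(zdGraph 3).incidenceFinset b \ edgesTouching (zdGraph 3) A, ?_, card_fresh_le ha heE,
      fun ω' hω' hd => ?_⟩
    · intro f hf
      rw [Finset.mem_coe, Finset.mem_sdiff, SimpleGraph.mem_incidenceFinset] at hf
      exact (zdGraph 3).incidenceSet_subset b hf.1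
    · have hbm : b ∈ box 3 (l * n) := by
        have ha' := hA.2 ha
        rw [Finset.mem_sdiff, mem_innerBoundary_iff] at ha'
        by_contra hbm
        exact ha'.2 ⟨ha'.1, b, hbm, heE⟩
      refine mem_blockedEv_of_card_le (hH ω' hω') (hA.1.trans (Finset.subset_insert b A))
        (Finset.insert_subset_iff.2 ⟨hbox hbm, hAbox.trans hbox⟩) ?_
      calc _ ≤ (((edgeBoundary (zdGraph 3) A).filter (· ∈ ω)).erase s(a, b)).card :=
            Finset.card_le_card (doors_insert_subset ha hb (hT ω') (hT' ω') hd)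
        _ ≤ k := by
            rw [Finset.card_erase_of_mem he]
            omega

end StubDoorKill

/-- **Door kill** (line pocket-resampling-liveness-mass, stub 4). -/
theorem stub_doorKill :
    ∀ (k n l : ℕ) (A : Finset (Site 3)) (ω : BondConfig (Site 3)), 2 ≤ l → 1 ≤ n →
      ω ⊆ (zdGraph 3).edgeSet →
      (box 3 n ⊆ A ∧ A ⊆ box 3 (l * n) \ innerBoundary (zdGraph 3) (box 3 (l * n))) →
      ((edgeBoundary (zdGraph 3) A).filter (· ∈ ω)).card ≤ k + 1 →
      (1 - ((criticalProbI 3 : unitInterval) : ℝ)) ^ 5 ≤ (bondPercolation (zdGraph 3) (criticalProbI 3)).real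
        {ω' : BondConfig (Site 3) | (ω ∩ ↑(edgesTouching (zdGraph 3) A)) ∪ (ω' \ ↑(edgesTouching (zdGraph 3) A)) ∈
          {ξ : BondConfig (Site 3) | ∃ S : Finset (Sym2 (Site 3)), S.card ≤ k ∧ ¬ ∃ x ∈ box 3 n,
            ∃ y ∈ innerBoundary (zdGraph 3) (box 3 (2 * l * n)),
              (ξ \ (↑S : Set (Sym2 (Site 3)))) ∈ openConnIn (↑(box 3 (2 * l * n)) : Set (Site 3)) x y}} := by
  intro k n l A ω hl hn hω hA hcard
  obtain ⟨X, hXE, hX5, hkill⟩ := StubDoorKill.exists_killSet hl hn hω hA hcard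
  have hp0 : (0 : ℝ) ≤ 1 - ((criticalProbI 3 : unitInterval) : ℝ) :=
    sub_nonneg.2 (criticalProbI 3).2.2
  have hp1 : 1 - ((criticalProbI 3 : unitInterval) : ℝ) ≤ 1 :=
    sub_le_self _ (criticalProbI 3).2.1
  calc (1 - ((criticalProbI 3 : unitInterval) : ℝ)) ^ 5
      ≤ (1 - ((criticalProbI 3 : unitInterval) : ℝ)) ^ X.card := pow_le_pow_of_le_one hp0 hp1 hX5
    _ = (bondPercolation (zdGraph 3) (criticalProbI 3)).real
          {ω' : BondConfig (Site 3) | Disjoint (↑X : Set (Sym2 (Site 3))) ω'} :=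
        (bondPercolation_real_setOf_disjoint (zdGraph 3) (criticalProbI 3) X hXE).symm
    _ ≤ _ := real_mono_of_lattice fun ω' hω' hd => hkill ω' hω' hd

end Summit.CriticalPhenomena.PercolationContinuityZ3.Theorems
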